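import Mathlib
import Literature.AlgebraicGeometry.Resolution.CobordantChartCoefficients

/-!
# Cobordant chart, II: multiplicativity of initial evaluations and one-move wins

Continuation of `CobordantChartCoefficients.lean` (crux `LocalWeightedDrop`,
stmt-ResolutionOfSingularities-8899; cdisprove refuter).  With `P_b(f)(c) = initEval w c b f` and
`∂ᵢP_b(f)(c) = initEvalD w c b f i`:

* `coeff_cons_zero_mul`, `coeff_cons_single_mul` — `coeff (b,0)` and `coeff (b,eᵢ)` of a product of
  series in `(s, y)` (antidiagonal bookkeeping);
* `initEval_mul`, `initEvalD_mul` — MULTIPLICATIVITY and LEIBNIZ: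
  `P_b(fg) = ∑_{b₁+b₂=b} P_{b₁}(f)P_{b₂}(g)`, `∂ᵢP_b(fg) = ∑ (∂ᵢP_{b₁}(f)P_{b₂}(g) + P_{b₁}(f)∂ᵢP_{b₂}(g))`;
* `initEval_coe`, `initEvalD_coe` — for a POLYNOMIAL germ these are honest evaluations of the
  weighted-homogeneous component and of its partial derivatives;
* `successor_nonsingular_of_isWeightedHomogeneous`, `crux_move_wins_of_isWeightedHomogeneous` —
  ONE-MOVE WINS: a non-zero `w`-weighted-homogeneous polynomial germ whose affine cone is smooth
  off the origin has NO singular `s`-saturated successor at any exceptional point of `B₊` under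
  the move `(θ = X, w)` — stated in the literal chart/guard form of the crux.  (Shape of
  Włodarczyk arXiv:2203.03090 Thm 4.2.2; covers Brieskorn–Pham germs with `p ∤ aᵢ`, cusps, `E₆`,
  `E₈`, …, reducing each to "`P(c) = ∇P(c) = 0 ⇒ c = 0`".)
-/

namespace Literature.AlgebraicGeometry.Resolution.CobordantChart

open MvPolynomial

variable {k : Type*} [Field k] {n : ℕ}

/-! ### Multiplicativity: `P_b` of a product, Leibniz for `∂P_b` -/

/-- An exponent of `Fin (n+1)` with zero tail is `cons (e 0) 0`. [folklore] -/
theorem eq_cons_zero_of_tail_eq_zero {e : Fin (n + 1) →₀ ℕ} (h : Finsupp.tail e = 0) :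
    e = Finsupp.cons (e 0) 0 := by
  rw [← Finsupp.cons_tail e, h]
  simp

/-- `coeff (b, 0)` of a product: only pairs `(b₁, 0) + (b₂, 0)` contribute. [folklore] -/
theorem coeff_cons_zero_mul (F G : MvPowerSeries (Fin (n + 1)) k) (b : ℕ) :
    MvPowerSeries.coeff (Finsupp.cons b 0) (F * G) =
      ∑ p ∈ Finset.HasAntidiagonal.antidiagonal b, MvPowerSeries.coeff (Finsupp.cons p.1 0) F *
        MvPowerSeries.coeff (Finsupp.cons p.2 0) G := by
  classical
  rw [MvPowerSeries.coeff_mul]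
  -- reindex the antidiagonal of `cons b 0` by the antidiagonal of `b`
  refine Finset.sum_nbij' (fun q => (q.1 0, q.2 0))
    (fun p => (Finsupp.cons p.1 0, Finsupp.cons p.2 0)) ?_ ?_ ?_ ?_ ?_
  · intro q hq
    rw [Finset.HasAntidiagonal.mem_antidiagonal] at hq ⊢
    have := congrArg (fun e => e 0) hq
    simpa using this
  · intro p hp
    rw [Finset.HasAntidiagonal.mem_antidiagonal] at hp ⊢
    ext j
    refine Fin.cases ?_ (fun i => ?_) j
    · simp [hp]
    · simp [Finsupp.cons_succ]
  · intro q hq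
    rw [Finset.HasAntidiagonal.mem_antidiagonal] at hq
    have ht : Finsupp.tail q.1 + Finsupp.tail q.2 = 0 := by
      ext i
      have := congrArg (fun e => e i.succ) hq
      simpa [Finsupp.tail_apply, Finsupp.cons_succ] using this
    have h1 : Finsupp.tail q.1 = 0 := by
      ext i
      have := congrArg (fun e => e i) ht
      simp only [Finsupp.add_apply, Finsupp.coe_zero, Pi.zero_apply] at this ⊢
      omega
    have h2 : Finsupp.tail q.2 = 0 := by
      ext i
      have := congrArg (fun e => e i) ht
      simp only [Finsupp.add_apply, Finsupp.coe_zero, Pi.zero_apply] at this ⊢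
      omega
    ext <;> simp [← eq_cons_zero_of_tail_eq_zero h1, ← eq_cons_zero_of_tail_eq_zero h2]
  · intro p _
    simp
  · intro q hq
    rw [Finset.HasAntidiagonal.mem_antidiagonal] at hq
    have ht : Finsupp.tail q.1 + Finsupp.tail q.2 = 0 := by
      ext i
      have := congrArg (fun e => e i.succ) hq
      simpa [Finsupp.tail_apply, Finsupp.cons_succ] using this
    have h1 : Finsupp.tail q.1 = 0 := by
      ext i
      have := congrArg (fun e => e i) ht
      simp only [Finsupp.add_apply, Finsupp.coe_zero, Pi.zero_apply] at this ⊢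
      omega
    have h2 : Finsupp.tail q.2 = 0 := by
      ext i
      have := congrArg (fun e => e i) ht
      simp only [Finsupp.add_apply, Finsupp.coe_zero, Pi.zero_apply] at this ⊢
      omega
    simp only
    rw [← eq_cons_zero_of_tail_eq_zero h1, ← eq_cons_zero_of_tail_eq_zero h2]

/-- MULTIPLICATIVITY of the evaluated initial parts: `P_b(fg)(c) = ∑_{b₁+b₂=b} P_{b₁}(f)(c) P_{b₂}(g)(c)`. [folklore] -/
theorem initEval_mul (w : Fin n → ℕ) (c : Fin n → k) (hc : ∀ i, w i = 0 → c i = 0)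
    (f g : MvPowerSeries (Fin n) k) (b : ℕ) :
    initEval w c b (f * g) = ∑ p ∈ Finset.HasAntidiagonal.antidiagonal b, initEval w c p.1 f * initEval w c p.2 g := by
  simp_rw [← coeff_cons_zero_subst_chart w c hc]
  rw [MvPowerSeries.subst_mul (hasSubst_chart w c hc), coeff_cons_zero_mul]

/-- `P_b` of a power of a series of `w`-order `≥ m`... special case used constantly:
`P_{pm}(f^p)(c) = P_m(f)(c)^p` in characteristic `p` is NOT claimed here; instead the general
`p`-fold product formula follows from `initEval_mul` by induction.  We record the square. [folklore] -/
theorem initEval_sq (w : Fin n → ℕ) (c : Fin n → k) (hc : ∀ i, w i = 0 → c i = 0)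
    (f : MvPowerSeries (Fin n) k) (b : ℕ) :
    initEval w c b (f ^ 2) = ∑ p ∈ Finset.HasAntidiagonal.antidiagonal b, initEval w c p.1 f * initEval w c p.2 f := by
  rw [pow_two, initEval_mul w c hc]

/-- Below the `w`-order, `P_b(f)(c) = 0`. [folklore] -/
theorem initEval_eq_zero_of_lt (w : Fin n → ℕ) (c : Fin n → k) (hc : ∀ i, w i = 0 → c i = 0)
    (f : MvPowerSeries (Fin n) k) {b : ℕ} (hb : (b : ℕ∞) < f.weightedOrder w) :
    initEval w c b f = 0 := by
  rw [← coeff_cons_zero_subst_chart w c hc, coeff_subst_chart_eq_zero_of_lt w c hc f hb]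


/-- In an antidiagonal pair of `cons b (single i 1)` the tails are `(single i 1, 0)` or `(0, single i 1)`. [folklore] -/
theorem tail_eq_or_of_mem_antidiagonal_cons_single {b : ℕ} {i : Fin n}
    {q : (Fin (n + 1) →₀ ℕ) × (Fin (n + 1) →₀ ℕ)}
    (hq : q ∈ Finset.HasAntidiagonal.antidiagonal (Finsupp.cons b (Finsupp.single i 1))) :
    (Finsupp.tail q.1 = Finsupp.single i 1 ∧ Finsupp.tail q.2 = 0) ∨
      (Finsupp.tail q.1 = 0 ∧ Finsupp.tail q.2 = Finsupp.single i 1) := by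
  classical
  rw [Finset.HasAntidiagonal.mem_antidiagonal] at hq
  have ht : Finsupp.tail q.1 + Finsupp.tail q.2 = Finsupp.single i 1 := by
    ext j
    have := congrArg (fun e => e j.succ) hq
    simpa [Finsupp.tail_apply, Finsupp.cons_succ] using this
  have hi := congrArg (fun e => e i) ht
  simp only [Finsupp.add_apply, Finsupp.single_eq_same] at hi
  have hj : ∀ j, j ≠ i → Finsupp.tail q.1 j = 0 ∧ Finsupp.tail q.2 j = 0 := by
    intro j hji
    have := congrArg (fun e => e j) ht
    simp only [Finsupp.add_apply, Finsupp.single_apply, Ne.symm hji, if_false] at this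
    omega
  rcases Nat.eq_zero_or_pos (Finsupp.tail q.1 i) with h1 | h1
  · right
    constructor
    · ext j
      by_cases hji : j = i
      · subst hji; simpa using h1
      · simpa using (hj j hji).1
    · ext j
      by_cases hji : j = i
      · subst hji; simp; omega
      · simp [Ne.symm hji, (hj j hji).2]
  · left
    constructor
    · ext j
      by_cases hji : j = i
      · subst hji; simp; omega
      · simp [Ne.symm hji, (hj j hji).1]
    · ext j
      by_cases hji : j = i
      · subst hji; simp; omega
      · simpa using (hj j hji).2

/-- An exponent of `Fin (n+1)` is `cons (e 0) (tail e)`. [folklore] -/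
theorem eq_cons_tail (e : Fin (n + 1) →₀ ℕ) : e = Finsupp.cons (e 0) (Finsupp.tail e) :=
  (Finsupp.cons_tail e).symm

/-- LEIBNIZ for `coeff (b, eᵢ)` of a product. [folklore] -/
theorem coeff_cons_single_mul (F G : MvPowerSeries (Fin (n + 1)) k) (b : ℕ) (i : Fin n) :
    MvPowerSeries.coeff (Finsupp.cons b (Finsupp.single i 1)) (F * G) =
      ∑ p ∈ Finset.HasAntidiagonal.antidiagonal b,
        (MvPowerSeries.coeff (Finsupp.cons p.1 (Finsupp.single i 1)) F *
            MvPowerSeries.coeff (Finsupp.cons p.2 0) G +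
          MvPowerSeries.coeff (Finsupp.cons p.1 0) F *
            MvPowerSeries.coeff (Finsupp.cons p.2 (Finsupp.single i 1)) G) := by
  classical
  rw [MvPowerSeries.coeff_mul, Finset.sum_add_distrib]
  rw [← Finset.sum_filter_add_sum_filter_not _ (fun q => Finsupp.tail q.1 = Finsupp.single i 1)]
  have hsingle : (Finsupp.single i 1 : Fin n →₀ ℕ) ≠ 0 := by
    intro h; have := congrArg (fun e => e i) h; simp at this
  congr 1
  · refine Finset.sum_nbij' (fun q => (q.1 0, q.2 0))
      (fun p => (Finsupp.cons p.1 (Finsupp.single i 1), Finsupp.cons p.2 0)) ?_ ?_ ?_ ?_ ?_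
    · intro q hq
      rw [Finset.mem_filter] at hq
      rw [Finset.HasAntidiagonal.mem_antidiagonal]
      have := congrArg (fun e => e 0) (Finset.HasAntidiagonal.mem_antidiagonal.mp hq.1)
      simpa using this
    · intro p hp
      rw [Finset.HasAntidiagonal.mem_antidiagonal] at hp
      rw [Finset.mem_filter, Finset.HasAntidiagonal.mem_antidiagonal]
      refine ⟨?_, by simp⟩
      ext j
      refine Fin.cases ?_ (fun i' => ?_) j
      · simp [hp]
      · simp [Finsupp.cons_succ]
    · intro q hq
      rw [Finset.mem_filter] at hq
      rcases tail_eq_or_of_mem_antidiagonal_cons_single hq.1 with ⟨h1, h2⟩ | ⟨h1, -⟩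
      · ext <;> simp
        · conv_rhs => rw [eq_cons_tail q.1, h1]
        · conv_rhs => rw [eq_cons_tail q.2, h2]
      · exact absurd (hq.2.symm.trans h1) hsingle
    · intro p _; simp
    · intro q hq
      rw [Finset.mem_filter] at hq
      rcases tail_eq_or_of_mem_antidiagonal_cons_single hq.1 with ⟨h1, h2⟩ | ⟨h1, -⟩
      · simp only
        conv_lhs => rw [eq_cons_tail q.1, h1, eq_cons_tail q.2, h2]
      · exact absurd (hq.2.symm.trans h1) hsingle
  · refine Finset.sum_nbij' (fun q => (q.1 0, q.2 0))
      (fun p => (Finsupp.cons p.1 0, Finsupp.cons p.2 (Finsupp.single i 1))) ?_ ?_ ?_ ?_ ?_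
    · intro q hq
      rw [Finset.mem_filter] at hq
      rw [Finset.HasAntidiagonal.mem_antidiagonal]
      have := congrArg (fun e => e 0) (Finset.HasAntidiagonal.mem_antidiagonal.mp hq.1)
      simpa using this
    · intro p hp
      rw [Finset.HasAntidiagonal.mem_antidiagonal] at hp
      rw [Finset.mem_filter, Finset.HasAntidiagonal.mem_antidiagonal]
      refine ⟨?_, by simpa using hsingle.symm⟩
      ext j
      refine Fin.cases ?_ (fun i' => ?_) j
      · simp [hp]
      · simp [Finsupp.cons_succ]
    · intro q hq
      rw [Finset.mem_filter] at hq
      rcases tail_eq_or_of_mem_antidiagonal_cons_single hq.1 with ⟨h1, -⟩ | ⟨h1, h2⟩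
      · exact absurd h1 hq.2
      · ext <;> simp
        · conv_rhs => rw [eq_cons_tail q.1, h1]
        · conv_rhs => rw [eq_cons_tail q.2, h2]
    · intro p _; simp
    · intro q hq
      rw [Finset.mem_filter] at hq
      rcases tail_eq_or_of_mem_antidiagonal_cons_single hq.1 with ⟨h1, -⟩ | ⟨h1, h2⟩
      · exact absurd h1 hq.2
      · simp only
        conv_lhs => rw [eq_cons_tail q.1, h1, eq_cons_tail q.2, h2]

/-- LEIBNIZ RULE for the evaluated initial parts:
`∂ᵢP_b(fg)(c) = ∑_{b₁+b₂=b} (∂ᵢP_{b₁}(f) P_{b₂}(g) + P_{b₁}(f) ∂ᵢP_{b₂}(g))(c)`. [folklore] -/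
theorem initEvalD_mul (w : Fin n → ℕ) (c : Fin n → k) (hc : ∀ i, w i = 0 → c i = 0)
    (f g : MvPowerSeries (Fin n) k) (b : ℕ) (i : Fin n) :
    initEvalD w c b (f * g) i = ∑ p ∈ Finset.HasAntidiagonal.antidiagonal b,
      (initEvalD w c p.1 f i * initEval w c p.2 g + initEval w c p.1 f * initEvalD w c p.2 g i) := by
  simp_rw [← coeff_cons_zero_subst_chart w c hc, ← coeff_cons_single_subst_chart w c hc]
  rw [MvPowerSeries.subst_mul (hasSubst_chart w c hc), coeff_cons_single_mul]


/-! ### Polynomial germs: `P_b` and `∂P_b` are honest evaluations -/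

/-- For a POLYNOMIAL germ, `P_b(c)` is the value at `c` of its `w`-weight-`b` component. [folklore] -/
theorem initEval_coe (w : Fin n → ℕ) (c : Fin n → k) (b : ℕ) (P : MvPolynomial (Fin n) k) :
    initEval w c b (P : MvPowerSeries (Fin n) k) =
      MvPolynomial.eval c (MvPolynomial.weightedHomogeneousComponent w b P) := by
  classical
  rw [initEval, finsum_eq_sum_of_support_subset (s := P.support)]
  · rw [MvPolynomial.eval_eq']
    have hsub : (MvPolynomial.weightedHomogeneousComponent w b P).support ⊆ P.support := by
      rw [MvPolynomial.support_weightedHomogeneousComponent]; exact Finset.filter_subset _ _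
    rw [Finset.sum_subset hsub (fun d _ hd => by
      rw [MvPolynomial.notMem_support_iff.mp hd, zero_mul])]
    refine Finset.sum_congr rfl fun d _ => ?_
    rw [MvPolynomial.coeff_weightedHomogeneousComponent, MvPolynomial.coeff_coe]
    split_ifs <;> simp
  · intro d hd
    rw [Function.mem_support] at hd
    rw [Finset.mem_coe, MvPolynomial.mem_support_iff]
    intro h0
    apply hd
    simp [MvPolynomial.coeff_coe, h0]

/-- For a POLYNOMIAL germ, `∂ᵢP_b(c)` is the value at `c` of the `i`-th partial derivative of
its `w`-weight-`b` component. [folklore] -/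
theorem initEvalD_coe (w : Fin n → ℕ) (c : Fin n → k) (b : ℕ) (P : MvPolynomial (Fin n) k)
    (i : Fin n) :
    initEvalD w c b (P : MvPowerSeries (Fin n) k) i =
      MvPolynomial.eval c (MvPolynomial.pderiv i (MvPolynomial.weightedHomogeneousComponent w b P)) := by
  classical
  rw [initEvalD, finsum_eq_sum_of_support_subset (s := P.support)]
  · conv_rhs => rw [(MvPolynomial.weightedHomogeneousComponent w b P).as_sum, map_sum, map_sum]
    have hsub : (MvPolynomial.weightedHomogeneousComponent w b P).support ⊆ P.support := by
      rw [MvPolynomial.support_weightedHomogeneousComponent]; exact Finset.filter_subset _ _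
    rw [Finset.sum_subset hsub (fun d _ hd => by
      rw [MvPolynomial.notMem_support_iff.mp hd]; simp)]
    refine Finset.sum_congr rfl fun d _ => ?_
    rw [MvPolynomial.coeff_weightedHomogeneousComponent, MvPolynomial.coeff_coe,
      MvPolynomial.pderiv_monomial, MvPolynomial.eval_monomial]
    split_ifs with hw
    · -- ∏ over `d - single i 1`
      rw [Finsupp.prod_pow, ← Finset.mul_prod_erase Finset.univ _ (Finset.mem_univ i)]
      have hrest : ∏ j ∈ Finset.univ.erase i, c j ^ ((d - Finsupp.single i 1 : Fin n →₀ ℕ) j) =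
          ∏ j ∈ Finset.univ.erase i, c j ^ (d j) := by
        refine Finset.prod_congr rfl fun j hj => ?_
        have hji : j ≠ i := (Finset.mem_erase.mp hj).1
        simp [Ne.symm hji]
      rw [hrest]
      simp only [Finsupp.coe_tsub, Pi.sub_apply, Finsupp.single_eq_same]
      ring
    · simp
  · intro d hd
    rw [Function.mem_support] at hd
    rw [Finset.mem_coe, MvPolynomial.mem_support_iff]
    intro h0
    apply hd
    simp [MvPolynomial.coeff_coe, h0]


/-! ### One-move wins: weighted-homogeneous germs with smooth affine cone -/

/-- The `w`-order of a non-zero `w`-homogeneous polynomial germ is its weighted degree. [folklore] -/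
theorem weightedOrder_coe_of_isWeightedHomogeneous (w : Fin n → ℕ) {P : MvPolynomial (Fin n) k}
    {a : ℕ} (hP : P.IsWeightedHomogeneous w a) (hP0 : P ≠ 0) :
    (P : MvPowerSeries (Fin n) k).weightedOrder w = a := by
  classical
  rw [MvPowerSeries.weightedOrder_eq_nat]
  constructor
  · obtain ⟨d, hd⟩ := MvPolynomial.ne_zero_iff.mp hP0
    exact ⟨d, by rwa [MvPolynomial.coeff_coe], hP hd⟩
  · intro d hd
    rw [MvPolynomial.coeff_coe]
    by_contra h
    have := hP h
    rw [this] at hd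
    exact lt_irrefl _ hd

/-- ONE-MOVE WIN.  Let `P` be a non-zero `w`-weighted-homogeneous polynomial whose affine cone
`{P = 0} ⊆ kⁿ` is smooth away from the origin (`P(c) = 0 ∧ ∇P(c) = 0 ⇒ c = 0`).  Then at every
exceptional point `c ≠ 0` of the cobordant blow-up with weights `w` (with `c_i = 0` where
`w_i = 0`) the `s`-saturated transform of the germ `P` is NON-SINGULAR.  (Brieskorn–Pham germs
`∑ xᵢ^{aᵢ}` with `p ∤ aᵢ`, cusps, `E₆`, `E₈`, … : Włodarczyk arXiv:2203.03090 Thm 4.2.2 shape.) [folklore] -/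
theorem successor_nonsingular_of_isWeightedHomogeneous (w : Fin n → ℕ) {P : MvPolynomial (Fin n) k}
    {a : ℕ} (hP : P.IsWeightedHomogeneous w a) (hP0 : P ≠ 0)
    (hcone : ∀ c : Fin n → k, MvPolynomial.eval c P = 0 →
      (∀ i, MvPolynomial.eval c (MvPolynomial.pderiv i P) = 0) → c = 0)
    (c : Fin n → k) (hc : ∀ i, w i = 0 → c i = 0) (hcne : c ≠ 0)
    {e : ℕ} {g : MvPowerSeries (Fin (n + 1)) k}
    (hfac : MvPowerSeries.subst (chart w c) (P : MvPowerSeries (Fin n) k) = MvPowerSeries.X 0 ^ e * g)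
    (hg : ¬ MvPowerSeries.X 0 ∣ g) :
    ¬ (MvPowerSeries.constantCoeff g = 0 ∧ ∀ j, MvPowerSeries.coeff (Finsupp.single j 1) g = 0) := by
  classical
  have hP0' : (P : MvPowerSeries (Fin n) k) ≠ 0 := by
    intro h; apply hP0; exact MvPolynomial.coe_eq_zero_iff.mp h
  have he : e = a := by
    have h1 := eq_weightedOrder_of_factor w c hc hP0' hfac hg
    rw [weightedOrder_coe_of_isWeightedHomogeneous w hP hP0] at h1
    exact_mod_cast h1
  subst he
  intro hsing
  obtain ⟨hPa, hD, -⟩ := (successor_singular_iff w c hc _ hfac).mp hsing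
  rw [initEval_coe, hP.weightedHomogeneousComponent_same] at hPa
  have hD' : ∀ i, MvPolynomial.eval c (MvPolynomial.pderiv i P) = 0 := by
    intro i
    have := hD i
    rwa [initEvalD_coe, hP.weightedHomogeneousComponent_same] at this
  exact hcne (hcone c hPa hD')

/-- The crux's form of the one-move win: from the germ `P` (as in
`successor_nonsingular_of_isWeightedHomogeneous`), the move `θ = X`, weights `w` leaves NO
singular `s`-saturated successor at any point of the exceptional divisor of `B₊` (the literal
chart family and off-vertex guard of `LocalWeightedDrop`). [folklore] -/
theorem crux_move_wins_of_isWeightedHomogeneous (w : Fin n → ℕ) {P : MvPolynomial (Fin n) k}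
    {a : ℕ} (hP : P.IsWeightedHomogeneous w a) (hP0 : P ≠ 0)
    (hcone : ∀ c : Fin n → k, MvPolynomial.eval c P = 0 →
      (∀ i, MvPolynomial.eval c (MvPolynomial.pderiv i P) = 0) → c = 0)
    (c : Fin n → k) (hoff : ∃ i, 0 < w i ∧ c i ≠ 0) (e : ℕ) (g : MvPowerSeries (Fin (n + 1)) k)
    (hfac : MvPowerSeries.subst (fun i : Fin n => if 0 < w i then
        MvPowerSeries.X (0 : Fin (n + 1)) ^ (w i) * (MvPowerSeries.C (c i) + MvPowerSeries.X i.succ)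
        else MvPowerSeries.X i.succ)
        (MvPowerSeries.subst (MvPowerSeries.X : Fin n → MvPowerSeries (Fin n) k)
          (P : MvPowerSeries (Fin n) k)) = MvPowerSeries.X 0 ^ e * g)
    (hg : ¬ MvPowerSeries.X 0 ∣ g) :
    ¬ (MvPowerSeries.constantCoeff g = 0 ∧ ∀ j, MvPowerSeries.coeff (Finsupp.single j 1) g = 0) := by
  rw [cruxChart_eq_chart, MvPowerSeries.subst_self] at hfac
  refine successor_nonsingular_of_isWeightedHomogeneous w hP hP0 hcone _ (fun i hi => ?_) ?_ hfac hg
  · have : ¬ 0 < w i := by omega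
    simp [this]
  · obtain ⟨i, hi, hci⟩ := hoff
    intro h
    have := congrFun h i
    simp [hi] at this
    exact hci this


end Literature.AlgebraicGeometry.Resolution.CobordantChart
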